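import Literature.NumberTheory.LFunctions.ConreyIwaniec2002Thm61DivisorMoments
import Mathlib.Analysis.SpecialFunctions.Pow.Real
import Mathlib.Analysis.Complex.ExponentialBounds
import Mathlib.MeasureTheory.Integral.Bochner.Set
import Mathlib.Tactic.IntervalCases
import HarnessLib

/-!
# Conrey–Iwaniec (2002), Theorem 6.1: elementary sums behind (6.27)–(6.28)

B. Conrey, H. Iwaniec, Acta Arith. 103 (2002), §6 (6.27)–(6.28) [held text `paper:arxiv-math_0111012`,
p0015:L52–92]. Arithmetic and bookkeeping used when (6.19) is applied on a smooth `ρ`-adic partition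
of unity and the pieces are summed:

* the two-sided geometric bound `Σ_k min((cr^k)^α, (cr^k)^{-β}) ≤ r^α/(r^α−1) + (1−r^{−β})⁻¹`
  (`sum_min_rpow_le`), whence the sum over the pieces `X_k = c r^k` of the (6.19)-errors
  `X_k^{3/4} log²(3X_k)(1+X_k/Y)⁻⁸ ≪ Y^{3/4}log²(3Y)` (`sum_pieces_le`) — this is the first error term
  `Bτ(h)Y^{3/4}(log Y)^4` of (6.27);
* the divisor sums of the "separated constituents" (third error term of (6.27)):
  `Σ_{n ≤ M} τ(n+h)τ(n) ≤ (M+h)(1+log(M+h))³` from `Σ_{n≤x}τ(n)² ≤ x(1+log x)³`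
  (tree `Sieve.Vaughan.sum_sq_card_divisors_le`);
* `σ₋₁(h) ≤ τ(h)`, logarithmic inequalities, and a bound for integrals over `(0,∞)` of functions
  supported in `(0, L]`.

PROVED HERE (namespace `ConreyIwaniec2002.Thm61ShiftedArith`), no `sorry`, no `def`. Toolkit for the
registered stub S2b `stub_thm61_shifted` of SKELETON P64 (line `thm61-cm-convolution`).

## References
* [ConreyIwaniec2002] B. Conrey, H. Iwaniec, Acta Arith. 103 (2002) 259–312: §6 (6.19), (6.27)–(6.28).
-/

noncomputable section

open Set Filter MeasureTheory Finset Real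

namespace Literature.NumberTheory.LFunctions

namespace ConreyIwaniec2002

namespace Thm61ShiftedArith

/-! ### Two-sided geometric sums -/

/-- `(r^k)^α = (r^α)^k` for `r ≥ 0`. [folklore] -/
private theorem rpow_pow_comm {r : ℝ} (hr : 0 ≤ r) (α : ℝ) (k : ℕ) :
    (r ^ k) ^ α = (r ^ α) ^ k := by
  rw [← Real.rpow_natCast r k, ← Real.rpow_mul hr, mul_comm, Real.rpow_mul hr, Real.rpow_natCast]

/-- **Two-sided geometric bound**: for `r > 1`, `c > 0`, `α, β > 0` and any finite set of
exponents, `Σ_k min((cr^k)^α, (cr^k)^{−β}) ≤ r^α/(r^α − 1) + (1 − r^{−β})⁻¹` (the terms with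
`cr^k ≤ 1` form a geometric series ending at `1`, the others one starting above `1`).
[cite: ConreyIwaniec2002, §6 (6.27)] -/
theorem sum_min_rpow_le {r c α β : ℝ} (hr : 1 < r) (hc : 0 < c) (hα : 0 < α) (hβ : 0 < β)
    (s : Finset ℕ) :
    ∑ k ∈ s, min ((c * r ^ k) ^ α) ((c * r ^ k) ^ (-β)) ≤
      r ^ α / (r ^ α - 1) + (1 - r ^ (-β))⁻¹ := by
  classical
  have hr0 : 0 ≤ r := by linarith
  have ht0 : ∀ k : ℕ, 0 < c * r ^ k := fun k => by positivity
  have hrα : 1 < r ^ α := Real.one_lt_rpow hr hα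
  have hq0 : 0 < r ^ (-β) := Real.rpow_pos_of_pos (by linarith) _
  have hq1 : r ^ (-β) < 1 := Real.rpow_lt_one_of_one_lt_of_neg hr (by linarith)
  have hA0 : 0 ≤ r ^ α / (r ^ α - 1) := div_nonneg (by linarith) (by linarith)
  have hB0 : 0 ≤ (1 - r ^ (-β))⁻¹ := inv_nonneg.2 (by linarith)
  set s₁ := s.filter (fun k => c * r ^ k ≤ 1) with hs₁
  set s₂ := s.filter (fun k => ¬ c * r ^ k ≤ 1) with hs₂
  have hsplit := Finset.sum_filter_add_sum_filter_not s (fun k => c * r ^ k ≤ 1)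
    (fun k => min ((c * r ^ k) ^ α) ((c * r ^ k) ^ (-β)))
  rw [← hs₁, ← hs₂] at hsplit
  rw [← hsplit]
  refine add_le_add ?_ ?_
  · -- the terms with `c r^k ≤ 1`
    by_cases hne : s₁.Nonempty
    · set m := s₁.max' hne with hm
      have hmem : m ∈ s₁ := s₁.max'_mem hne
      have htm : c * r ^ m ≤ 1 := (Finset.mem_filter.1 hmem).2
      have hle : ∀ k ∈ s₁, k ≤ m := fun k hk => s₁.le_max' k hk
      calc ∑ k ∈ s₁, min ((c * r ^ k) ^ α) ((c * r ^ k) ^ (-β))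
          ≤ ∑ k ∈ s₁, (c * r ^ k) ^ α := Finset.sum_le_sum fun k _ => min_le_left _ _
        _ ≤ ∑ k ∈ Finset.range (m + 1), (c * r ^ k) ^ α :=
            Finset.sum_le_sum_of_subset_of_nonneg
              (fun k hk => Finset.mem_range.2 (Nat.lt_succ_of_le (hle k hk)))
              (fun _ _ _ => by positivity)
        _ = c ^ α * ∑ k ∈ Finset.range (m + 1), (r ^ α) ^ k := by
            rw [Finset.mul_sum]
            refine Finset.sum_congr rfl fun k _ => ?_
            rw [Real.mul_rpow hc.le (pow_nonneg hr0 k), rpow_pow_comm hr0]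
        _ = c ^ α * (((r ^ α) ^ (m + 1) - 1) / (r ^ α - 1)) := by rw [geom_sum_eq hrα.ne']
        _ ≤ c ^ α * ((r ^ α) ^ (m + 1) / (r ^ α - 1)) :=
            mul_le_mul_of_nonneg_left
              (div_le_div_of_nonneg_right (by linarith) (by linarith)) (by positivity)
        _ = (c * r ^ m) ^ α * (r ^ α / (r ^ α - 1)) := by
            rw [Real.mul_rpow hc.le (pow_nonneg hr0 m), rpow_pow_comm hr0, pow_succ]
            ring
        _ ≤ 1 * (r ^ α / (r ^ α - 1)) := by
            gcongr
            exact Real.rpow_le_one (ht0 m).le htm hα.le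
        _ = r ^ α / (r ^ α - 1) := one_mul _
    · rw [Finset.not_nonempty_iff_eq_empty.1 hne, Finset.sum_empty]
      exact hA0
  · -- the terms with `c r^k > 1`
    by_cases hne : s₂.Nonempty
    · set m := s₂.min' hne with hm
      have hmem : m ∈ s₂ := s₂.min'_mem hne
      have htm : 1 < c * r ^ m := not_le.1 (Finset.mem_filter.1 hmem).2
      have hge : ∀ k ∈ s₂, m ≤ k := fun k hk => s₂.min'_le k hk
      set M := s₂.max' hne with hM
      have hleM : ∀ k ∈ s₂, k ≤ M := fun k hk => s₂.le_max' k hk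
      have hsub : s₂ ⊆ Finset.Ico m (M + 1) := fun k hk =>
        Finset.mem_Ico.2 ⟨hge k hk, Nat.lt_succ_of_le (hleM k hk)⟩
      calc ∑ k ∈ s₂, min ((c * r ^ k) ^ α) ((c * r ^ k) ^ (-β))
          ≤ ∑ k ∈ s₂, (r ^ (-β)) ^ (k - m) := by
            refine Finset.sum_le_sum fun k hk => (min_le_right _ _).trans ?_
            have hkm := hge k hk
            have e : c * r ^ k = (c * r ^ m) * r ^ (k - m) := by
              rw [mul_assoc, ← pow_add, Nat.add_sub_cancel' hkm]
            rw [e, Real.mul_rpow (ht0 m).le (pow_nonneg hr0 _), rpow_pow_comm hr0]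
            exact mul_le_of_le_one_left (by positivity)
              (Real.rpow_le_one_of_one_le_of_nonpos htm.le (by linarith))
        _ ≤ ∑ k ∈ Finset.Ico m (M + 1), (r ^ (-β)) ^ (k - m) :=
            Finset.sum_le_sum_of_subset_of_nonneg hsub (fun _ _ _ => by positivity)
        _ = ∑ j ∈ Finset.range (M + 1 - m), (r ^ (-β)) ^ j := by
            rw [Finset.sum_Ico_eq_sum_range]
            refine Finset.sum_congr rfl fun j _ => ?_
            rw [Nat.add_sub_cancel_left]
        _ ≤ ∑' j : ℕ, (r ^ (-β)) ^ j :=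
            (summable_geometric_of_lt_one hq0.le hq1).sum_le_tsum _ (fun _ _ => by positivity)
        _ = (1 - r ^ (-β))⁻¹ := tsum_geometric_of_lt_one hq0.le hq1
    · rw [Finset.not_nonempty_iff_eq_empty.1 hne, Finset.sum_empty]
      exact hB0

/-! ### The sum over the pieces of the (6.19)-errors -/

/-- `1 ≤ log(3Y)` for `Y ≥ 2`. [folklore] -/
private theorem one_le_log_three_mul {Y : ℝ} (hY : 2 ≤ Y) : 1 ≤ Real.log (3 * Y) := by
  rw [← Real.log_exp 1]
  refine Real.log_le_log (Real.exp_pos 1) ?_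
  have := Real.exp_one_lt_d9
  linarith

/-- `log(3X) ≤ log(3Y)·(1 + X/Y)` for `X ≥ 1/3`, `Y ≥ 2`. [folklore] -/
private theorem log_piece_le {X Y : ℝ} (hX : 1 / 3 ≤ X) (hY : 2 ≤ Y) :
    0 ≤ Real.log (3 * X) ∧ Real.log (3 * X) ≤ Real.log (3 * Y) * (1 + X / Y) := by
  have hY0 : 0 < Y := by linarith
  have hX0 : 0 < X := by linarith
  have h1 := one_le_log_three_mul hY
  refine ⟨Real.log_nonneg (by linarith), ?_⟩
  have e : Real.log (3 * X) = Real.log (3 * Y) + Real.log (X / Y) := by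
    rw [← Real.log_mul (by positivity) (by positivity)]; congr 1; field_simp
  have h2 : Real.log (X / Y) ≤ X / Y := (Real.log_le_sub_one_of_pos (by positivity)).trans (by linarith)
  rw [e]
  nlinarith [div_pos hX0 hY0]

/-- **The first error term of (6.27) summed over the pieces**: for pieces `X_k = c r^k ≥ 1/3`
(`r > 1`, `c > 0`) and `Y ≥ 2`,
`Σ_k X_k^{3/4} log²(3X_k) (1 + X_k/Y)⁻⁸ ≤ (r^{3/4}/(r^{3/4}−1) + (1−r^{−21/4})⁻¹)·Y^{3/4}log²(3Y)`.
[cite: ConreyIwaniec2002, §6 (6.27)] -/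
theorem sum_pieces_le {r c Y : ℝ} (hr : 1 < r) (hc : 0 < c) (hY : 2 ≤ Y) (s : Finset ℕ)
    (hs : ∀ k ∈ s, 1 / 3 ≤ c * r ^ k) :
    ∑ k ∈ s, (c * r ^ k) ^ (3 / 4 : ℝ) * Real.log (3 * (c * r ^ k)) ^ 2 *
        ((1 + c * r ^ k / Y) ^ 8)⁻¹ ≤
      (r ^ (3 / 4 : ℝ) / (r ^ (3 / 4 : ℝ) - 1) + (1 - r ^ (-(21 / 4) : ℝ))⁻¹) *
        Y ^ (3 / 4 : ℝ) * Real.log (3 * Y) ^ 2 := by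
  have hY0 : 0 < Y := by linarith
  have hr0 : 0 ≤ r := by linarith
  have hlog := one_le_log_three_mul hY
  set G : ℝ := r ^ (3 / 4 : ℝ) / (r ^ (3 / 4 : ℝ) - 1) + (1 - r ^ (-(21 / 4) : ℝ))⁻¹ with hG
  -- termwise: `X^{3/4} log²(3X) (1+X/Y)^{-8} ≤ Y^{3/4} log²(3Y) min(t^{3/4}, t^{-21/4})`, `t = X/Y`
  have hterm : ∀ k ∈ s,
      (c * r ^ k) ^ (3 / 4 : ℝ) * Real.log (3 * (c * r ^ k)) ^ 2 * ((1 + c * r ^ k / Y) ^ 8)⁻¹ ≤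
        Y ^ (3 / 4 : ℝ) * Real.log (3 * Y) ^ 2 *
          min ((c / Y * r ^ k) ^ (3 / 4 : ℝ)) ((c / Y * r ^ k) ^ (-(21 / 4) : ℝ)) := by
    intro k hk
    set X : ℝ := c * r ^ k with hX
    have hX0 : 0 < X := by positivity
    set t : ℝ := X / Y with ht
    have ht0 : 0 < t := by positivity
    have hct : c / Y * r ^ k = t := by rw [ht, hX]; ring
    rw [hct]
    obtain ⟨hl0, hl⟩ := log_piece_le (hs k hk) hY
    have h1t : 1 ≤ 1 + t := by linarith
    -- `log²(3X) ≤ log²(3Y)(1+t)²`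
    have hlog2 : Real.log (3 * X) ^ 2 ≤ Real.log (3 * Y) ^ 2 * (1 + t) ^ 2 := by
      rw [← mul_pow]; exact pow_le_pow_left₀ hl0 hl 2
    -- `X^{3/4} = Y^{3/4} t^{3/4}`
    have hXt : X ^ (3 / 4 : ℝ) = Y ^ (3 / 4 : ℝ) * t ^ (3 / 4 : ℝ) := by
      rw [← Real.mul_rpow hY0.le ht0.le]; congr 1; rw [ht]; field_simp
    -- `t^{3/4}(1+t)^{-6} ≤ min(t^{3/4}, t^{-21/4})`
    have hmin : t ^ (3 / 4 : ℝ) * ((1 + t) ^ 6)⁻¹ ≤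
        min (t ^ (3 / 4 : ℝ)) (t ^ (-(21 / 4) : ℝ)) := by
      refine le_min ?_ ?_
      · exact mul_le_of_le_one_right (by positivity) (inv_le_one_of_one_le₀ (one_le_pow₀ h1t))
      · have h6 : ((1 + t) ^ 6)⁻¹ ≤ t ^ (-(6:ℝ)) := by
          rw [Real.rpow_neg ht0.le, show (6:ℝ) = ((6:ℕ):ℝ) by norm_num, Real.rpow_natCast]
          exact inv_anti₀ (by positivity) (pow_le_pow_left₀ ht0.le (by linarith) 6)
        calc t ^ (3 / 4 : ℝ) * ((1 + t) ^ 6)⁻¹ ≤ t ^ (3 / 4 : ℝ) * t ^ (-(6:ℝ)) :=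
              mul_le_mul_of_nonneg_left h6 (by positivity)
          _ = t ^ (-(21 / 4) : ℝ) := by rw [← Real.rpow_add ht0]; norm_num
    have hsplit : ((1 + t) ^ 8)⁻¹ = ((1 + t) ^ 2)⁻¹ * ((1 + t) ^ 6)⁻¹ := by
      rw [← mul_inv, ← pow_add]
    calc X ^ (3 / 4 : ℝ) * Real.log (3 * X) ^ 2 * ((1 + X / Y) ^ 8)⁻¹
        = X ^ (3 / 4 : ℝ) * Real.log (3 * X) ^ 2 * ((1 + t) ^ 8)⁻¹ := by rw [ht]
      _ ≤ (Y ^ (3 / 4 : ℝ) * t ^ (3 / 4 : ℝ)) * (Real.log (3 * Y) ^ 2 * (1 + t) ^ 2) *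
            ((1 + t) ^ 8)⁻¹ := by
          rw [hXt]
          exact mul_le_mul_of_nonneg_right (mul_le_mul_of_nonneg_left hlog2 (by positivity))
            (by positivity)
      _ = Y ^ (3 / 4 : ℝ) * Real.log (3 * Y) ^ 2 * (t ^ (3 / 4 : ℝ) * ((1 + t) ^ 6)⁻¹) := by
          rw [hsplit]
          have : (1 + t) ^ 2 * ((1 + t) ^ 2)⁻¹ = 1 := mul_inv_cancel₀ (by positivity)
          calc (Y ^ (3 / 4 : ℝ) * t ^ (3 / 4 : ℝ)) * (Real.log (3 * Y) ^ 2 * (1 + t) ^ 2) *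
                (((1 + t) ^ 2)⁻¹ * ((1 + t) ^ 6)⁻¹)
              = Y ^ (3 / 4 : ℝ) * Real.log (3 * Y) ^ 2 * (t ^ (3 / 4 : ℝ) * ((1 + t) ^ 6)⁻¹) *
                  ((1 + t) ^ 2 * ((1 + t) ^ 2)⁻¹) := by ring
            _ = _ := by rw [this, mul_one]
      _ ≤ Y ^ (3 / 4 : ℝ) * Real.log (3 * Y) ^ 2 *
            min (t ^ (3 / 4 : ℝ)) (t ^ (-(21 / 4) : ℝ)) :=
          mul_le_mul_of_nonneg_left hmin (by positivity)
  calc ∑ k ∈ s, (c * r ^ k) ^ (3 / 4 : ℝ) * Real.log (3 * (c * r ^ k)) ^ 2 *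
          ((1 + c * r ^ k / Y) ^ 8)⁻¹
      ≤ ∑ k ∈ s, Y ^ (3 / 4 : ℝ) * Real.log (3 * Y) ^ 2 *
          min ((c / Y * r ^ k) ^ (3 / 4 : ℝ)) ((c / Y * r ^ k) ^ (-(21 / 4) : ℝ)) :=
        Finset.sum_le_sum hterm
    _ = Y ^ (3 / 4 : ℝ) * Real.log (3 * Y) ^ 2 *
          ∑ k ∈ s, min ((c / Y * r ^ k) ^ (3 / 4 : ℝ)) ((c / Y * r ^ k) ^ (-(21 / 4) : ℝ)) := by
        rw [Finset.mul_sum]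
    _ ≤ Y ^ (3 / 4 : ℝ) * Real.log (3 * Y) ^ 2 * G := by
        refine mul_le_mul_of_nonneg_left ?_ (by positivity)
        have h := sum_min_rpow_le hr (div_pos hc hY0) (by norm_num : (0:ℝ) < 3 / 4)
          (by norm_num : (0:ℝ) < 21 / 4) s
        rwa [hG]
    _ = G * Y ^ (3 / 4 : ℝ) * Real.log (3 * Y) ^ 2 := by ring

/-! ### Divisor sums of the separated constituents -/

/-- `Σ_{n ∈ [1, M]} τ(n+h)τ(n) ≤ (M+h)(1+log(M+h))³` (via `2τ(n+h)τ(n) ≤ τ(n+h)² + τ(n)²` and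
`Σ_{m≤x}τ(m)² ≤ x(1+log x)³`). [cite: ConreyIwaniec2002, §6 (6.27)] -/
theorem sum_tau_shift_mul_le (M h : ℕ) :
    ∑ n ∈ Finset.Icc 1 M, ((Nat.divisors (n + h)).card : ℝ) * (Nat.divisors n).card ≤
      ((M + h : ℕ) : ℝ) * (1 + Real.log ((M + h : ℕ) : ℝ)) ^ 3 := by
  have hsq : ∀ K : ℕ, ∑ m ∈ Finset.Icc 1 K, ((Nat.divisors m).card : ℝ) ^ 2 ≤
      K * (1 + Real.log K) ^ 3 := by
    intro K
    have h := Literature.NumberTheory.Sieve.Vaughan.sum_sq_card_divisors_le K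
    have e : Finset.Icc 1 K = Finset.Ioc 0 K := by
      ext n; simp only [Finset.mem_Icc, Finset.mem_Ioc]; omega
    rw [e]; exact_mod_cast h
  have hmono : ∀ K L : ℕ, K ≤ L → ∑ m ∈ Finset.Icc 1 K, ((Nat.divisors m).card : ℝ) ^ 2 ≤
      ∑ m ∈ Finset.Icc 1 L, ((Nat.divisors m).card : ℝ) ^ 2 := fun K L hKL =>
    Finset.sum_le_sum_of_subset_of_nonneg (Finset.Icc_subset_Icc_right hKL)
      (fun _ _ _ => by positivity)
  have hshift : ∑ n ∈ Finset.Icc 1 M, ((Nat.divisors (n + h)).card : ℝ) ^ 2 ≤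
      ∑ m ∈ Finset.Icc 1 (M + h), ((Nat.divisors m).card : ℝ) ^ 2 := by
    rw [← Finset.sum_image (s := Finset.Icc 1 M) (g := fun n => n + h)
      (f := fun m => ((Nat.divisors m).card : ℝ) ^ 2) (fun a _ b _ hab => by simpa using hab)]
    refine Finset.sum_le_sum_of_subset_of_nonneg (fun m hm => ?_) (fun _ _ _ => by positivity)
    obtain ⟨n, hn, rfl⟩ := Finset.mem_image.1 hm
    rw [Finset.mem_Icc] at hn ⊢; omega
  calc ∑ n ∈ Finset.Icc 1 M, ((Nat.divisors (n + h)).card : ℝ) * (Nat.divisors n).card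
      ≤ ∑ n ∈ Finset.Icc 1 M, ((((Nat.divisors (n + h)).card : ℝ) ^ 2 +
          ((Nat.divisors n).card : ℝ) ^ 2) / 2) :=
        Finset.sum_le_sum fun n _ => by
          nlinarith [sq_nonneg (((Nat.divisors (n + h)).card : ℝ) - (Nat.divisors n).card)]
    _ = ((∑ n ∈ Finset.Icc 1 M, ((Nat.divisors (n + h)).card : ℝ) ^ 2) +
          ∑ n ∈ Finset.Icc 1 M, ((Nat.divisors n).card : ℝ) ^ 2) / 2 := by
        rw [← Finset.sum_div, Finset.sum_add_distrib]
    _ ≤ ((∑ m ∈ Finset.Icc 1 (M + h), ((Nat.divisors m).card : ℝ) ^ 2) +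
          ∑ m ∈ Finset.Icc 1 (M + h), ((Nat.divisors m).card : ℝ) ^ 2) / 2 :=
        div_le_div_of_nonneg_right (add_le_add hshift (hmono M (M + h) (by omega))) (by norm_num)
    _ = ∑ m ∈ Finset.Icc 1 (M + h), ((Nat.divisors m).card : ℝ) ^ 2 := by ring
    _ ≤ ((M + h : ℕ) : ℝ) * (1 + Real.log ((M + h : ℕ) : ℝ)) ^ 3 := hsq (M + h)

/-- `σ₋₁(h) = Σ_{d∣h} d⁻¹ ≤ τ(h)`. [cite: ConreyIwaniec2002, §6 (6.20)] -/
theorem sum_divisors_inv_le_card (h : ℕ) :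
    ∑ d ∈ Nat.divisors h, (d : ℝ)⁻¹ ≤ (Nat.divisors h).card := by
  have : ∀ d ∈ Nat.divisors h, (d : ℝ)⁻¹ ≤ 1 := fun d hd => by
    have hd1 : 1 ≤ d := Nat.pos_of_mem_divisors hd
    exact inv_le_one_of_one_le₀ (by exact_mod_cast hd1)
  calc ∑ d ∈ Nat.divisors h, (d : ℝ)⁻¹ ≤ ∑ d ∈ Nat.divisors h, (1:ℝ) := Finset.sum_le_sum this
    _ = (Nat.divisors h).card := by simp

/-! ### Logarithmic bookkeeping -/

/-- `log(3Y)² ≤ 4(1 + log(hY))⁴` for `Y ≥ 2`, `h ≥ 1` (`log 3 ≤ 2`): the passage from the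
`(log 3X)²` of (6.19) to the `(log hY)⁴` of (6.28). [cite: ConreyIwaniec2002, §6 (6.27)–(6.28)] -/
theorem log_three_mul_sq_le {Y : ℝ} (hY : 2 ≤ Y) {h : ℕ} (hh : 1 ≤ h) :
    Real.log (3 * Y) ^ 2 ≤ 4 * (1 + Real.log (h * Y)) ^ 4 := by
  have hY0 : 0 < Y := by linarith
  have hh1 : (1:ℝ) ≤ h := by exact_mod_cast hh
  have hlog3 : Real.log 3 ≤ 2 := by
    rw [← Real.log_exp 2]
    refine Real.log_le_log (by norm_num) ?_
    have h1 := Real.exp_one_gt_d9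
    have : Real.exp 2 = Real.exp 1 * Real.exp 1 := by rw [← Real.exp_add]; norm_num
    nlinarith
  have hlogY : 0 ≤ Real.log Y := Real.log_nonneg (by linarith)
  have hlogh : 0 ≤ Real.log h := Real.log_nonneg hh1
  have e1 : Real.log (3 * Y) = Real.log 3 + Real.log Y := Real.log_mul (by norm_num) hY0.ne'
  have e2 : Real.log (h * Y) = Real.log h + Real.log Y := Real.log_mul (by positivity) hY0.ne'
  have h0 : 0 ≤ Real.log (3 * Y) := by rw [e1]; have := Real.log_nonneg (by norm_num : (1:ℝ) ≤ 3); linarith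
  have h1 : Real.log (3 * Y) ≤ 2 * (1 + Real.log (h * Y)) := by rw [e1, e2]; linarith
  have h2 : 1 ≤ 1 + Real.log (h * Y) := by rw [e2]; linarith
  calc Real.log (3 * Y) ^ 2 ≤ (2 * (1 + Real.log (h * Y))) ^ 2 := pow_le_pow_left₀ h0 h1 2
    _ = 4 * (1 + Real.log (h * Y)) ^ 2 := by ring
    _ ≤ 4 * (1 + Real.log (h * Y)) ^ 4 := by
        have := pow_le_pow_right₀ h2 (by norm_num : 2 ≤ 4)
        linarith

/-- `1 + log(12h) ≤ 4(1 + log(hY))` for `h ≥ 1`, `Y ≥ 2` (`log 12 ≤ 3`): the passage from the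
`(log 3h)³` of (6.27) to the `(log hY)` powers of (6.28). [cite: ConreyIwaniec2002, §6 (6.27)–(6.28)] -/
theorem one_add_log_twelve_mul_le {Y : ℝ} (hY : 2 ≤ Y) {h : ℕ} (hh : 1 ≤ h) :
    0 ≤ 1 + Real.log (12 * h) ∧ 1 + Real.log (12 * h) ≤ 4 * (1 + Real.log (h * Y)) := by
  have hY0 : 0 < Y := by linarith
  have hh1 : (1:ℝ) ≤ h := by exact_mod_cast hh
  have hlog12 : Real.log 12 ≤ 3 := by
    rw [← Real.log_exp 3]
    refine Real.log_le_log (by norm_num) ?_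
    have h1 := Real.exp_one_gt_d9
    have : Real.exp 3 = Real.exp 1 * Real.exp 1 * Real.exp 1 := by
      rw [← Real.exp_add, ← Real.exp_add]; norm_num
    nlinarith [Real.exp_pos 1, mul_pos (Real.exp_pos 1) (Real.exp_pos 1)]
  have hlogY : 0 ≤ Real.log Y := Real.log_nonneg (by linarith)
  have hlogh : 0 ≤ Real.log h := Real.log_nonneg hh1
  have e1 : Real.log (12 * h) = Real.log 12 + Real.log h := Real.log_mul (by norm_num) (by positivity)
  have e2 : Real.log (h * Y) = Real.log h + Real.log Y := Real.log_mul (by positivity) hY0.ne'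
  have h12 : 0 ≤ Real.log 12 := Real.log_nonneg (by norm_num)
  rw [e1, e2]
  constructor <;> nlinarith

/-! ### Integrals over `(0,∞)` of functions living on `(0, L]` -/

/-- If `‖f‖ ≤ C` on `(0,∞)` and `f = 0` on `(L, ∞)` (`L ≥ 0`) then `‖∫_{(0,∞)} f‖ ≤ C·L` (the shape
of the trivial estimate `∫₀^{2h}|a(x+h)a(x)|(x/hT)²dx ≪ T⁻²h` of the second error term of (6.27)).
[cite: ConreyIwaniec2002, §6 (6.27)] -/
theorem norm_integral_Ioi_le_of_support {f : ℝ → ℂ} {C L : ℝ} (hL : 0 ≤ L)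
    (hC : ∀ x, 0 < x → ‖f x‖ ≤ C) (hf : ∀ x, L < x → f x = 0) :
    ‖∫ x in Ioi (0:ℝ), f x‖ ≤ C * L := by
  have hC0 : 0 ≤ C := by
    rcases eq_or_lt_of_le hL with h | h
    · by_cases hx : ‖f 1‖ ≤ C
      · exact (norm_nonneg _).trans hx
      · exact absurd (hC 1 one_pos) hx
    · exact (norm_nonneg _).trans (hC L h)
  rw [setIntegral_eq_of_subset_of_forall_sdiff_eq_zero measurableSet_Ioi
    (Ioc_subset_Ioi_self : Ioc (0:ℝ) L ⊆ Ioi 0) (fun x hx => hf x ?_)]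
  · calc ‖∫ x in Ioc (0:ℝ) L, f x‖ ≤ C * (volume : Measure ℝ).real (Ioc (0:ℝ) L) :=
          norm_setIntegral_le_of_norm_le_const measure_Ioc_lt_top fun x hx => hC x hx.1
      _ = C * L := by rw [Real.volume_real_Ioc_of_le hL, sub_zero]
  · have h1 : (0:ℝ) < x := hx.1
    by_contra hxL
    exact hx.2 ⟨h1, not_lt.1 hxL⟩

end Thm61ShiftedArith

end ConreyIwaniec2002

end Literature.NumberTheory.LFunctions

end
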